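import Summits.QuantumAdvantage.QuantumAdvantage.Theorems.NearExactIsExact.Negative.CornerFlatRankFour
import Summits.QuantumAdvantage.QuantumAdvantage.Theorems.NearExactIsExact.Negative.CornerFlatThreeFlat

/-!
# Corner-flat pairs of rank 4 (imbalance-4 almost-MM habitat AMM₂), II: the `15/16` ceiling

Negative-side (disprover lane, unit `b2b-cforr-disprove-g33`, 2026-08-23) sequel of
`Negative/CornerFlatRankFour.lean` (the exact formula `Φ = 1 − #mismatches/2^{a+3}` for the rank-4
corner-flat family, `cfr_forrelation_eq`) for the crux `CubicForrelation.NearExactIsExact`.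

* `cfr_sum_signOf_le`, `cfr_fibre_sum_le_twelve` — a fibre whose two eight-corner halves `s = 0, 1` of `h`
  are both odd carries `≥ 2` mismatches (sixteen-corner sign sum `≤ 12`).
* `cfr_cube_xor` — the sixteen-corner sum of a cubic over `b + span(v₁,…,v₄)` vanishes (fourth derivative),
  so the two halves of a fibre have the same parity.
* `cfr_cube3_deg` (re-nesting of `CornerFlatThreeFlat.cft_flat3_deg`), `cfr_minor_pluecker`,
  `cfr_minor_deg` — the eight-corner sum over `w + span(u₂,u₃,u₄)` has `x₁`-degree `≤ 2` because the
  `3 × 3` minors of `(u₄,u₃,u₂)` are the contractions `B ∧ u₂` of the Plücker 2-vector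
  `B = u₁∧u₂ ⊕ u₃∧u₄`, which is affine when `deg f ≤ 3`, and the frame is affine.
* `cfr_forrelation_le_fifteen_sixteenths` — hence ONE non-isotropic fibre gives `≥ 2^{a-2}` of them
  (`stub_rmWeight`) and `2^{a+4}·Φ ≤ 16·2^a − 4·2^{a-2}·4/4… = 15·2^a`, i.e. `Φ(f,g) ≤ 15/16`: the window
  `(15/16, 1)` part of the imbalance-4 corner-flat habitat is ISOTROPIC (the cubic part of `h` vanishes on
  every fibre flat), completing `CornerFlatThreeFlat.lean` into a forrelation statement.

Everything is over the standard three axioms; `decide` only on small Boolean identities.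
-/

set_option linter.dupNamespace false -- D-0017: single-problem summit ⇒ `QuantumAdvantage.QuantumAdvantage` by design

noncomputable section

namespace Summit.QuantumAdvantage.QuantumAdvantage.Theorems.NearExactIsExact.Negative.CornerFlatRankFour

open Finset
open Literature.Computability.QuantumComplexity
open Literature.Computability.QuantumComplexity.BuzetChailloux (bxor zeroVec twist_bxor_right
  twist_zeroVec_right bxor_eq_zeroVec_iff sum_twist_left)
open Literature.Computability.QuantumComplexity.DerivativeWalsh (W)
open Summit.QuantumAdvantage.QuantumAdvantage.Theorems.CubicForrelation.NearExactIsExact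
open Summit.QuantumAdvantage.QuantumAdvantage.Theorems.NearExactIsExact.Negative.CornerFlatThreeFlat
  (cft_flat3_deg)

variable {a m : ℕ}

section Ceiling

/-! ### The `15/16` ceiling off the isotropic sub-habitat -/

/-- A sign sum with two distinct `−1` entries is at most `card − 4`. [folklore] -/
theorem cfr_sum_signOf_le {ι : Type*} [Fintype ι] [DecidableEq ι] (K : ι → Bool) (q₀ q₁ : ι)
    (hne : q₀ ≠ q₁) (h₀ : K q₀ = true) (h₁ : K q₁ = true) :
    ∑ q, signOf (K q) ≤ (Fintype.card ι : ℝ) - 4 := by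
  have hpt : ∀ q, signOf (K q) = 1 - 2 * (if K q = true then (1 : ℝ) else 0) := by
    intro q
    cases K q <;> norm_num [signOf]
  rw [sum_congr rfl fun q _ => hpt q, sum_sub_distrib, sum_const, ← mul_sum, sum_boole, card_univ,
    nsmul_eq_mul, mul_one]
  have h2 : 2 ≤ (univ.filter fun q => K q = true).card := by
    calc 2 = (({q₀, q₁} : Finset ι)).card := (card_pair hne).symm
      _ ≤ _ := by
        refine card_le_card fun q hq => ?_
        simp only [mem_insert, mem_singleton] at hq
        rw [mem_filter]
        rcases hq with rfl | rfl
        · exact ⟨mem_univ _, h₀⟩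
        · exact ⟨mem_univ _, h₁⟩
  have h2' : (2 : ℝ) ≤ ((univ.filter fun q => K q = true).card : ℝ) := by exact_mod_cast h2
  linarith

/-- **One fibre, rank 4.**  The sixteen-corner sign sum `∑_q (-1)^{h(corner q) ⊕ e ⊕ st ⊕ s't'}` is `≤ 12`
as soon as BOTH eight-corner halves `s = s₀` (`s₀ = 0, 1`) of `h` have odd parity: the dual quadratic
`e ⊕ st ⊕ s't'` has even parity on each half, so each half carries a mismatch. [folklore] -/
theorem cfr_fibre_sum_le_twelve (h : (Fin m → Bool) → Bool)
    (cx : (Bool × Bool) × (Bool × Bool) → (Fin m → Bool)) (e : Bool)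
    (hodd : ∀ s₀ : Bool, (((h (cx ((s₀, false), (false, false))) ^^ h (cx ((s₀, false), (false, true)))) ^^
        (h (cx ((s₀, false), (true, false))) ^^ h (cx ((s₀, false), (true, true))))) ^^
        ((h (cx ((s₀, true), (false, false))) ^^ h (cx ((s₀, true), (false, true)))) ^^
          (h (cx ((s₀, true), (true, false))) ^^ h (cx ((s₀, true), (true, true)))))) = true) :
    ∑ q : (Bool × Bool) × (Bool × Bool), signOf (h (cx q) ^^ e ^^ (q.1.1 && q.1.2) ^^ (q.2.1 && q.2.2)) ≤ 12 := by
  have L : ∀ d0 d1 d2 d3 d4 d5 d6 d7 e s₀ : Bool,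
      (((d0 ^^ d1) ^^ (d2 ^^ d3)) ^^ ((d4 ^^ d5) ^^ (d6 ^^ d7))) = true →
      ((d0 ^^ e ^^ (s₀ && false) ^^ (false && false)) || (d1 ^^ e ^^ (s₀ && false) ^^ (false && true)) ||
        (d2 ^^ e ^^ (s₀ && false) ^^ (true && false)) || (d3 ^^ e ^^ (s₀ && false) ^^ (true && true)) ||
        (d4 ^^ e ^^ (s₀ && true) ^^ (false && false)) || (d5 ^^ e ^^ (s₀ && true) ^^ (false && true)) ||
        (d6 ^^ e ^^ (s₀ && true) ^^ (true && false)) || (d7 ^^ e ^^ (s₀ && true) ^^ (true && true))) =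
        true := by
    decide
  have ex : ∀ s₀ : Bool, ∃ q : (Bool × Bool) × (Bool × Bool), q.1.1 = s₀ ∧
      (h (cx q) ^^ e ^^ (q.1.1 && q.1.2) ^^ (q.2.1 && q.2.2)) = true := by
    intro s₀
    have L' := L _ _ _ _ _ _ _ _ e s₀ (hodd s₀)
    simp only [Bool.or_eq_true] at L'
    rcases L' with ((((((k | k) | k) | k) | k) | k) | k) | k
    · exact ⟨((s₀, false), (false, false)), rfl, k⟩
    · exact ⟨((s₀, false), (false, true)), rfl, k⟩
    · exact ⟨((s₀, false), (true, false)), rfl, k⟩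
    · exact ⟨((s₀, false), (true, true)), rfl, k⟩
    · exact ⟨((s₀, true), (false, false)), rfl, k⟩
    · exact ⟨((s₀, true), (false, true)), rfl, k⟩
    · exact ⟨((s₀, true), (true, false)), rfl, k⟩
    · exact ⟨((s₀, true), (true, true)), rfl, k⟩
  obtain ⟨q₀, hq₀, k₀⟩ := ex false
  obtain ⟨q₁, hq₁, k₁⟩ := ex true
  have hne : q₀ ≠ q₁ := by
    rintro rfl
    rw [hq₀] at hq₁
    exact Bool.false_ne_true hq₁
  have key := cfr_sum_signOf_le
    (fun q : (Bool × Bool) × (Bool × Bool) => h (cx q) ^^ e ^^ (q.1.1 && q.1.2) ^^ (q.2.1 && q.2.2))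
    q₀ q₁ hne k₀ k₁
  have h16 : (Fintype.card ((Bool × Bool) × (Bool × Bool)) : ℝ) - 4 ≤ 12 := by
    norm_num [Fintype.card_prod, Fintype.card_bool]
  exact key.trans h16

/-- **The sixteen-corner sum of a cubic vanishes**: for `deg h ≤ 3` and any `b, v₁, v₂, v₃, v₄`,
`⊕_{ε ∈ 𝔽₂⁴} h(b ⊕ Σ εᵢvᵢ) = 0` (a fourth derivative of a cubic; `stub_derivDegree` thrice and
`acq_const_of_deg_zero`).  Written as `G(b) ⊕ G(b ⊕ v₁) = 0` with `G(y)` the eight-corner sum over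
`y + span(v₂,v₃,v₄)`. [folklore] -/
theorem cfr_cube_xor {h : (Fin m → Bool) → Bool} (hh : IsDegLeFun 3 h) (b v₁ v₂ v₃ v₄ : Fin m → Bool) :
    ((((h b ^^ h (bxor b v₄)) ^^ (h (bxor b v₃) ^^ h (bxor (bxor b v₃) v₄))) ^^
        ((h (bxor b v₂) ^^ h (bxor (bxor b v₂) v₄)) ^^ (h (bxor (bxor b v₂) v₃) ^^ h (bxor (bxor (bxor b v₂) v₃) v₄)))) ^^
      (((h (bxor b v₁) ^^ h (bxor (bxor b v₁) v₄)) ^^ (h (bxor (bxor b v₁) v₃) ^^ h (bxor (bxor (bxor b v₁) v₃) v₄))) ^^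
        ((h (bxor (bxor b v₁) v₂) ^^ h (bxor (bxor (bxor b v₁) v₂) v₄)) ^^ (h (bxor (bxor (bxor b v₁) v₂) v₃) ^^ h (bxor (bxor (bxor (bxor b v₁) v₂) v₃) v₄))))) = false := by
  have h2 := stub_derivDegree m 2 h v₄ hh
  have h1 := stub_derivDegree m 1 _ v₃ h2
  have h0 := stub_derivDegree m 0 _ v₂ h1
  have e1 := acq_const_of_deg_zero h0 b
  have e2 := acq_const_of_deg_zero h0 (bxor b v₁)
  beta_reduce at e1 e2
  rw [e1, e2, Bool.xor_self]

/-- `x ⊕ (s ⊕ t) = (x ⊕ t) ⊕ s` (re-nesting of corner points). -/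
theorem cfr_bxor_swap (x s t : Fin m → Bool) : bxor x (bxor s t) = bxor (bxor x t) s := by
  funext j
  show (x j ^^ (s j ^^ t j)) = ((x j ^^ t j) ^^ s j)
  cases x j <;> cases s j <;> cases t j <;> rfl

/-- `x ⊕ 0 = x` with `0` written as a constant lambda. -/
theorem cfr_bxor_false (x : Fin m → Bool) : bxor x (fun _ => false) = x := by
  funext j
  show (x j ^^ false) = x j
  exact Bool.xor_false _

/-- **Eight-corner sums have degree `≤ D`** (re-nesting of `cft_flat3_deg`): with the frame `(s,t,r) :=
(v₄, v₃, v₂)` the eight-corner sum of `h` over `b(x) + span(v₂,v₃,v₄)(x)`, written in the nesting `G` of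
`cfr_cube_xor`, has `x`-degree `≤ D` when the `3 × 3` minors have degree `≤ D`. [folklore] -/
theorem cfr_cube3_deg {h : (Fin m → Bool) → Bool} (hh : IsDegLeFun 3 h)
    {b v₂ v₃ v₄ : (Fin a → Bool) → (Fin m → Bool)} {D : ℕ}
    (hdet : ∀ i j k, i ≠ j → i ≠ k → j ≠ k → IsDegLeFun D (fun x =>
      (v₄ x i && ((v₃ x j && v₂ x k) ^^ (v₃ x k && v₂ x j))) ^^
        (v₄ x j && ((v₃ x i && v₂ x k) ^^ (v₃ x k && v₂ x i))) ^^
        (v₄ x k && ((v₃ x i && v₂ x j) ^^ (v₃ x j && v₂ x i))))) :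
    IsDegLeFun D (fun x =>
      (((h (b x) ^^ h (bxor (b x) (v₄ x))) ^^ (h (bxor (b x) (v₃ x)) ^^ h (bxor (bxor (b x) (v₃ x)) (v₄ x)))) ^^
        ((h (bxor (b x) (v₂ x)) ^^ h (bxor (bxor (b x) (v₂ x)) (v₄ x))) ^^ (h (bxor (bxor (b x) (v₂ x)) (v₃ x)) ^^ h (bxor (bxor (bxor (b x) (v₂ x)) (v₃ x)) (v₄ x)))))) :=
  rm_isDegLeFun_congr (cft_flat3_deg (b := b) hh hdet) fun x => by
    simp only [cfr_bxor_swap, Bool.xor_assoc]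

/-- The `3 × 3` minors of `(u₄, u₃, u₂)` are the contractions `B ∧ u₂` of the Plücker 2-vector
`B = u₁∧u₂ ⊕ u₃∧u₄` of the rank-4 form (Boolean identity, twelve variables). -/
theorem cfr_minor_pluecker : ∀ a₁ a₂ a₃ b₁ b₂ b₃ c₁ c₂ c₃ d₁ d₂ d₃ : Bool,
    ((d₁ && ((c₂ && b₃) ^^ (c₃ && b₂))) ^^ (d₂ && ((c₁ && b₃) ^^ (c₃ && b₁))) ^^
        (d₃ && ((c₁ && b₂) ^^ (c₂ && b₁)))) =
      ((((((a₁ && b₂) ^^ (a₂ && b₁)) ^^ ((c₁ && d₂) ^^ (c₂ && d₁))) && b₃) ^^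
        ((((a₁ && b₃) ^^ (a₃ && b₁)) ^^ ((c₁ && d₃) ^^ (c₃ && d₁))) && b₂)) ^^
        ((((a₂ && b₃) ^^ (a₃ && b₂)) ^^ ((c₂ && d₃) ^^ (c₃ && d₂))) && b₁)) := by
  decide

/-- **Minors of a cubic rank-4 corner-flat family have degree `≤ 2`**: if the Plücker 2-vector
`B(x) = u₁∧u₂ ⊕ u₃∧u₄` is coordinatewise affine (forced by `deg f ≤ 3`, cf. `AmmCeilingX.acx_deg_polar`)
and `u₂` is coordinatewise affine (an affine frame), then every `3 × 3` minor of `(u₄,u₃,u₂)(x)` — a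
contraction `B ∧ u₂` — has degree `≤ 2`. [folklore] -/
theorem cfr_minor_deg {u₁ u₂ u₃ u₄ : (Fin a → Bool) → (Fin m → Bool)}
    (hB : ∀ i j, IsDegLeFun 1 (fun x =>
      ((u₁ x i && u₂ x j) ^^ (u₁ x j && u₂ x i)) ^^ ((u₃ x i && u₄ x j) ^^ (u₃ x j && u₄ x i))))
    (hu₂ : ∀ j, IsDegLeFun 1 (fun x => u₂ x j)) (i j k : Fin m) :
    IsDegLeFun 2 (fun x =>
      (u₄ x i && ((u₃ x j && u₂ x k) ^^ (u₃ x k && u₂ x j))) ^^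
        (u₄ x j && ((u₃ x i && u₂ x k) ^^ (u₃ x k && u₂ x i))) ^^
        (u₄ x k && ((u₃ x i && u₂ x j) ^^ (u₃ x j && u₂ x i)))) := by
  have key : IsDegLeFun 2 (fun x =>
      ((((u₁ x i && u₂ x j) ^^ (u₁ x j && u₂ x i)) ^^ ((u₃ x i && u₄ x j) ^^ (u₃ x j && u₄ x i))) &&
          u₂ x k) ^^
        ((((u₁ x i && u₂ x k) ^^ (u₁ x k && u₂ x i)) ^^ ((u₃ x i && u₄ x k) ^^ (u₃ x k && u₄ x i))) &&
          u₂ x j) ^^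
        ((((u₁ x j && u₂ x k) ^^ (u₁ x k && u₂ x j)) ^^ ((u₃ x j && u₄ x k) ^^ (u₃ x k && u₄ x j))) &&
          u₂ x i)) :=
    fc_deg_bxor (fc_deg_bxor (acq_deg_band (hB i j) (hu₂ k) (by norm_num))
      (acq_deg_band (hB i k) (hu₂ j) (by norm_num))) (acq_deg_band (hB j k) (hu₂ i) (by norm_num))
  exact rm_isDegLeFun_congr key fun x => (cfr_minor_pluecker _ _ _ _ _ _ _ _ _ _ _ _).symm

/-- **Abstract counting step.**  In the rank-4 corner-flat family: if the fibres cut out by a Boolean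
function `E` of `x₁`-degree `≤ 2` all have corner sum `≤ 12` (two mismatches) and there is at least one of
them, then `Φ(f,g) ≤ 15/16` — there are `≥ 2^(a-2)` such fibres by the Reed–Muller weight bound
(`stub_rmWeight`).  The isotropy ceiling below is the instance `E = ` eight-corner sum; finer obstructions
(any degree-`≤ 2` witness of two mismatches per fibre) plug in here. [folklore] -/
theorem cfr_forrelation_le_of_bad_fibres (l : (Fin (a + 4) → Bool) → (Fin (a + 4) → Bool) → Bool)
    (hl : ∀ y x, signOf (l y x) = twist x y)
    (u₁ u₂ u₃ u₄ w : (Fin a → Bool) → (Fin (a + 4) → Bool)) (f₀ : (Fin a → Bool) → Bool)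
    (φ : (Fin (a + 4) → Bool) → (Fin a → Bool)) (h : (Fin (a + 4) → Bool) → Bool)
    (f g : (Fin (a + (a + 4)) → Bool) → Bool)
    (hf : ∀ x₁ x₂, f (Fin.append x₁ x₂) =
      ((l (u₁ x₁) x₂ && l (u₂ x₁) x₂) ^^ (l (u₃ x₁) x₂ && l (u₄ x₁) x₂) ^^ l (w x₁) x₂ ^^ f₀ x₁))
    (hg : ∀ (y₁ : Fin a → Bool) (y₂ : Fin (a + 4) → Bool),
      signOf (g (Fin.append y₁ y₂)) = twist y₁ (φ y₂) * signOf (h y₂))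
    (corner : (Fin a → Bool) → (Bool × Bool) × (Bool × Bool) → (Fin (a + 4) → Bool))
    (hc : ∀ x₁ q j, corner x₁ q j =
      (w x₁ j ^^ (q.1.1 && u₁ x₁ j) ^^ (q.1.2 && u₂ x₁ j) ^^ (q.2.1 && u₃ x₁ j) ^^ (q.2.2 && u₄ x₁ j)))
    (hφ : ∀ x₁ q, φ (corner x₁ q) = x₁) (hinj : ∀ x₁, Function.Injective (corner x₁))
    (E : (Fin a → Bool) → Bool) (hE : IsDegLeFun 2 E)
    (hbad : ∀ x₁, E x₁ = true →
      ∑ q : (Bool × Bool) × (Bool × Bool),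
        signOf (h (corner x₁ q) ^^ f₀ x₁ ^^ (q.1.1 && q.1.2) ^^ (q.2.1 && q.2.2)) ≤ 12)
    (hone : ∃ x₀ : Fin a → Bool, E x₀ = true) :
    forrelation f g ≤ 15 / 16 := by
  classical
  have hcount := stub_rmWeight stub_derivDegree a 2 E hE hone
  have hcountR : (2 : ℝ) ^ a ≤ 4 * ((univ.filter fun x : Fin a → Bool => E x = true).card : ℝ) := by
    rw [← show (2 : ℝ) ^ 2 = 4 by norm_num]
    exact_mod_cast hcount
  -- per-fibre bounds
  have hfib : ∀ x : Fin a → Bool,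
      ∑ q : (Bool × Bool) × (Bool × Bool),
          signOf (h (corner x q) ^^ f₀ x ^^ (q.1.1 && q.1.2) ^^ (q.2.1 && q.2.2)) ≤
        if E x = true then 12 else 16 := by
    intro x
    split_ifs with hx
    · exact hbad x hx
    · calc ∑ q : (Bool × Bool) × (Bool × Bool),
            signOf (h (corner x q) ^^ f₀ x ^^ (q.1.1 && q.1.2) ^^ (q.2.1 && q.2.2))
          ≤ ∑ _q : (Bool × Bool) × (Bool × Bool), (1 : ℝ) := sum_le_sum fun q _ =>
            (le_abs_self _).trans (abs_signOf _).le
        _ = 16 := by norm_num [sum_const, card_univ]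
  have hcard : ((univ.filter fun x : Fin a → Bool => E x = true).card : ℝ) +
      ((univ.filter fun x : Fin a → Bool => ¬E x = true).card : ℝ) = 2 ^ a := by
    rw [← Nat.cast_add, Finset.card_filter_add_card_filter_not, card_univ, Fintype.card_fun,
      Fintype.card_bool, Fintype.card_fin]
    push_cast
    ring
  have hS : ∑ x : Fin a → Bool, ∑ q : (Bool × Bool) × (Bool × Bool),
        signOf (h (corner x q) ^^ f₀ x ^^ (q.1.1 && q.1.2) ^^ (q.2.1 && q.2.2)) ≤
      12 * ((univ.filter fun x : Fin a → Bool => E x = true).card : ℝ) +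
      16 * ((univ.filter fun x : Fin a → Bool => ¬E x = true).card : ℝ) := by
    refine (sum_le_sum fun x _ => hfib x).trans (le_of_eq ?_)
    rw [Finset.sum_ite, sum_const, sum_const, nsmul_eq_mul, nsmul_eq_mul]
    ring
  rw [cfr_forrelation_eq l hl u₁ u₂ u₃ u₄ w f₀ φ h f g hf hg corner hc hφ hinj]
  have hpos : (0 : ℝ) < 2 ^ (a + 4) := by positivity
  rw [inv_mul_le_iff₀ hpos, pow_succ, pow_succ, pow_succ, pow_succ]
  linarith

/-- **`Φ ≤ 15/16` off the isotropic sub-habitat (rank 4).**  In the rank-4 corner-flat family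
(`cfr_forrelation_eq`), if `h` is cubic, the `3 × 3` minors of the frame triple `(u₄,u₃,u₂)` have
`x₁`-degree `≤ 2` (e.g. `cfr_minor_deg`), and SOME fibre has odd eight-corner sum over the 3-subflat
`w + span(u₂,u₃,u₄)` (the cubic part of `h` is not isotropic there), then at least `2^(a-2)` fibres have that
property (`cfr_cube3_deg` + `stub_rmWeight`), each carries two mismatches (`cfr_fibre_sum_le_twelve`,
`cfr_cube_xor`), and `Φ(f,g) ≤ 1 - 2·2^(a-2)/2^(a+3) = 15/16`.  Window members of the habitat are therefore
ISOTROPIC: the cubic part of `h` sums to zero over every 3-subflat of every fibre. [folklore] -/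
theorem cfr_forrelation_le_fifteen_sixteenths (l : (Fin (a + 4) → Bool) → (Fin (a + 4) → Bool) → Bool)
    (hl : ∀ y x, signOf (l y x) = twist x y)
    (u₁ u₂ u₃ u₄ w : (Fin a → Bool) → (Fin (a + 4) → Bool)) (f₀ : (Fin a → Bool) → Bool)
    (φ : (Fin (a + 4) → Bool) → (Fin a → Bool)) (h : (Fin (a + 4) → Bool) → Bool)
    (f g : (Fin (a + (a + 4)) → Bool) → Bool)
    (hf : ∀ x₁ x₂, f (Fin.append x₁ x₂) =
      ((l (u₁ x₁) x₂ && l (u₂ x₁) x₂) ^^ (l (u₃ x₁) x₂ && l (u₄ x₁) x₂) ^^ l (w x₁) x₂ ^^ f₀ x₁))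
    (hg : ∀ (y₁ : Fin a → Bool) (y₂ : Fin (a + 4) → Bool),
      signOf (g (Fin.append y₁ y₂)) = twist y₁ (φ y₂) * signOf (h y₂))
    (corner : (Fin a → Bool) → (Bool × Bool) × (Bool × Bool) → (Fin (a + 4) → Bool))
    (hc : ∀ x₁ q j, corner x₁ q j =
      (w x₁ j ^^ (q.1.1 && u₁ x₁ j) ^^ (q.1.2 && u₂ x₁ j) ^^ (q.2.1 && u₃ x₁ j) ^^ (q.2.2 && u₄ x₁ j)))
    (hφ : ∀ x₁ q, φ (corner x₁ q) = x₁) (hinj : ∀ x₁, Function.Injective (corner x₁))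
    (hh : IsDegLeFun 3 h)
    (hdet : ∀ i j k, i ≠ j → i ≠ k → j ≠ k → IsDegLeFun 2 (fun x =>
      (u₄ x i && ((u₃ x j && u₂ x k) ^^ (u₃ x k && u₂ x j))) ^^
        (u₄ x j && ((u₃ x i && u₂ x k) ^^ (u₃ x k && u₂ x i))) ^^
        (u₄ x k && ((u₃ x i && u₂ x j) ^^ (u₃ x j && u₂ x i)))))
    (hone : ∃ x₀ : Fin a → Bool,
      (((h (w x₀) ^^ h (bxor (w x₀) (u₄ x₀))) ^^ (h (bxor (w x₀) (u₃ x₀)) ^^ h (bxor (bxor (w x₀) (u₃ x₀)) (u₄ x₀)))) ^^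
        ((h (bxor (w x₀) (u₂ x₀)) ^^ h (bxor (bxor (w x₀) (u₂ x₀)) (u₄ x₀))) ^^ (h (bxor (bxor (w x₀) (u₂ x₀)) (u₃ x₀)) ^^ h (bxor (bxor (bxor (w x₀) (u₂ x₀)) (u₃ x₀)) (u₄ x₀))))) = true) :
    forrelation f g ≤ 15 / 16 := by
  refine cfr_forrelation_le_of_bad_fibres l hl u₁ u₂ u₃ u₄ w f₀ φ h f g hf hg corner hc hφ hinj _
    (cfr_cube3_deg (b := w) hh hdet) (fun x hx => ?_) hone
  refine cfr_fibre_sum_le_twelve h (corner x) (f₀ x) fun s₀ => ?_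
  have cube := cfr_cube_xor hh (w x) (u₁ x) (u₂ x) (u₃ x) (u₄ x)
  rw [hx, Bool.true_xor, Bool.not_eq_false'] at cube
  cases s₀
  · simpa only [cfr_corner_eq (corner x) (hc x), Bool.true_and, Bool.false_and, cfr_bxor_false]
      using hx
  · simpa only [cfr_corner_eq (corner x) (hc x), Bool.true_and, Bool.false_and, cfr_bxor_false]
      using cube

/-- Contrapositive, for planners: a rank-4 corner-flat pair (cubic `h`, minors of degree `≤ 2`) with
`Φ(f,g) > 15/16` is ISOTROPIC — at every `x₁` the eight-corner sum of `h` over `w(x₁) + span(u₂,u₃,u₄)(x₁)`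
vanishes (the cubic part of `h` is totally isotropic on every fibre flat). [folklore] -/
theorem cfr_window_isotropic (l : (Fin (a + 4) → Bool) → (Fin (a + 4) → Bool) → Bool)
    (hl : ∀ y x, signOf (l y x) = twist x y)
    (u₁ u₂ u₃ u₄ w : (Fin a → Bool) → (Fin (a + 4) → Bool)) (f₀ : (Fin a → Bool) → Bool)
    (φ : (Fin (a + 4) → Bool) → (Fin a → Bool)) (h : (Fin (a + 4) → Bool) → Bool)
    (f g : (Fin (a + (a + 4)) → Bool) → Bool)
    (hf : ∀ x₁ x₂, f (Fin.append x₁ x₂) =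
      ((l (u₁ x₁) x₂ && l (u₂ x₁) x₂) ^^ (l (u₃ x₁) x₂ && l (u₄ x₁) x₂) ^^ l (w x₁) x₂ ^^ f₀ x₁))
    (hg : ∀ (y₁ : Fin a → Bool) (y₂ : Fin (a + 4) → Bool),
      signOf (g (Fin.append y₁ y₂)) = twist y₁ (φ y₂) * signOf (h y₂))
    (corner : (Fin a → Bool) → (Bool × Bool) × (Bool × Bool) → (Fin (a + 4) → Bool))
    (hc : ∀ x₁ q j, corner x₁ q j =
      (w x₁ j ^^ (q.1.1 && u₁ x₁ j) ^^ (q.1.2 && u₂ x₁ j) ^^ (q.2.1 && u₃ x₁ j) ^^ (q.2.2 && u₄ x₁ j)))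
    (hφ : ∀ x₁ q, φ (corner x₁ q) = x₁) (hinj : ∀ x₁, Function.Injective (corner x₁))
    (hh : IsDegLeFun 3 h)
    (hdet : ∀ i j k, i ≠ j → i ≠ k → j ≠ k → IsDegLeFun 2 (fun x =>
      (u₄ x i && ((u₃ x j && u₂ x k) ^^ (u₃ x k && u₂ x j))) ^^
        (u₄ x j && ((u₃ x i && u₂ x k) ^^ (u₃ x k && u₂ x i))) ^^
        (u₄ x k && ((u₃ x i && u₂ x j) ^^ (u₃ x j && u₂ x i)))))
    (hwin : 15 / 16 < forrelation f g) (x₁ : Fin a → Bool) :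
    (((h (w x₁) ^^ h (bxor (w x₁) (u₄ x₁))) ^^ (h (bxor (w x₁) (u₃ x₁)) ^^ h (bxor (bxor (w x₁) (u₃ x₁)) (u₄ x₁)))) ^^
        ((h (bxor (w x₁) (u₂ x₁)) ^^ h (bxor (bxor (w x₁) (u₂ x₁)) (u₄ x₁))) ^^ (h (bxor (bxor (w x₁) (u₂ x₁)) (u₃ x₁)) ^^ h (bxor (bxor (bxor (w x₁) (u₂ x₁)) (u₃ x₁)) (u₄ x₁))))) = false :=
  Bool.eq_false_iff.mpr fun hx => absurd hwin (not_lt.mpr (cfr_forrelation_le_fifteen_sixteenths l hl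
    u₁ u₂ u₃ u₄ w f₀ φ h f g hf hg corner hc hφ hinj hh hdet ⟨x₁, hx⟩))

end Ceiling

end Summit.QuantumAdvantage.QuantumAdvantage.Theorems.NearExactIsExact.Negative.CornerFlatRankFour

end
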